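import Summits.AnomalousDissipation.AnomalousDissipation.Theses.PointSink
import Summits.AnomalousDissipation.AnomalousDissipation.Theorems.PointSinkConeDesingularisationStubEnvelopeOfFarField

/-!
# Negative knowledge for the crux `ConeDesingularisation` (stmt-AnomalousDissipation-19034, route PointSink):
# I. The far-field clause alone pins the `L²`-mass of the soliton — floor, infinite energy, sharp envelope

Certified copy of §1–§2 of the cdisprove work file `Cruxes/ConeDesingularisation/Disproof.lean`
(refuter-cdisprove-stmt-AnomalousDissipation-19034-0, cycle 1). Supports stmt-AnomalousDissipation-19034;
nothing here asserts a Theses decl positively. The DSS change of variables and the shell integrability are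
REUSED from the landed stub file `PointSinkConeDesingularisationStubEnvelopeOfFarField`
(`coneEnvelope_setIntegral_shell_normSq`, `coneEnvelope_integrableOn_shell`).

The crux is `PointFluxCone → CascadeSoliton` (`Iff.rfl`). Every clause below is a clause of its CONCLUSION
(the cascade soliton `Q` with a discretely self-similar far field `V` of degree `-2/3`,
`V (λ • x) = λ^{-2/3} • V x`, `‖V‖²` locally integrable off the origin, non-trivial on the fundamental shell,
`(λ^k)^{-5/3} ∫_{λ^k<‖x‖<λ^{k+1}} ‖Q − V‖² → 0`).

* `shell_mass_floor` — TIGHTNESS of the far-field clause: for every continuous `Q` shell-asymptotic to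
  `V`, eventually `(λ^k)^{5/3} · (∫_{1<‖x‖<λ}‖V‖²)/4 ≤ ∫_{λ^k<‖x‖<λ^{k+1}} ‖Q‖²` (the landed stub 4 is the
  matching CEILING `≤ 2(M+m)(λ^k)^{5/3}`): the soliton's mass growth is Galdi-critical from BOTH sides.
* `not_integrable_normSq_of_farField`, `cascadeSoliton_infinite_energy` — refuted natural strengthening
  `Q ∈ L²(ℝ³)`: a cascade soliton has INFINITE kinetic energy.
* `not_envelope_of_lt`, `not_cascadeSoliton_with_envelope_lt` — refuted natural strengthening of the
  envelope: no exponent `s < 5/3` is possible, not even along `R = λ^{k+1}`.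
* `coneDesingularisation_with_envelope_lt_iff` — with a sub-critical envelope the crux collapses to
  `¬ PointFluxCone`, i.e. to the death of the route by its own kill criterion (k1).

Reading for the prover: no Liouville theorem whose hypothesis is `Q ∈ L²`, `o(R^{5/3})` mass, or (by
Hölder on the shells, work file) `Q ∈ L^p` for `2 ≤ p ≤ 9/2` can bite the conclusion; and no construction
may aim at a sub-critical envelope.
-/

noncomputable section

-- `Summit.<Summit>.<Problem>`: single-conjunct summit, the duplicate namespace is mandated (CONVENTIONS §2).
set_option linter.dupNamespace false

open MeasureTheory Filter Topology Set
open Literature.Analysis.FunctionSpaces Literature.Analysis.FluidPDE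

namespace Summit.AnomalousDissipation.AnomalousDissipation.Theorems.ConeDesingularisation.Negative

open Summit.AnomalousDissipation.AnomalousDissipation.Theses.PointSink
  (PointFluxCone ConeDesingularisation CascadeSoliton)
open Summit.AnomalousDissipation.AnomalousDissipation.Theorems
  (coneEnvelope_setIntegral_shell_normSq coneEnvelope_integrableOn_shell)

/-! ## The shell-mass floor -/

/-- **Shell-mass floor (tightness of the far-field clause).** If a continuous `Q` is shell-`L²`
asymptotic at rate `o((λ^k)^{5/3})` to a measurable `V`, DSS of degree `-2/3` with `‖V‖²` locally
integrable off the origin, then eventually `(λ^k)^{5/3} · c₀/4 ≤ ∫_{λ^k<‖x‖<λ^{k+1}} ‖Q‖²`,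
`c₀ = ∫_{1<‖x‖<λ} ‖V‖²`: the soliton carries at least a quarter of the cone's mass on every far shell
(pointwise `‖V‖² ≤ 2‖Q‖² + 2‖Q−V‖²`, the DSS scaling `∫_{shell k}‖V‖² = (λ^k)^{5/3} c₀`, and the shell
error eventually below `(λ^k)^{5/3} c₀/4`). [folklore] -/
theorem shell_mass_floor {lam : ℝ} {V Q : EuclideanSpace ℝ (Fin 3) → EuclideanSpace ℝ (Fin 3)}
    (hlam : 1 < lam) (hQ : Continuous Q) (hV : AEStronglyMeasurable V volume)
    (hVss : ∀ x : EuclideanSpace ℝ (Fin 3), x ≠ 0 → V (lam • x) = lam ^ (-(2 / 3 : ℝ)) • V x)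
    (hVloc : LocallyIntegrableOn (fun x => ‖V x‖ ^ 2) {x : EuclideanSpace ℝ (Fin 3) | x ≠ 0} volume)
    (hTend : Tendsto (fun k : ℕ => (lam ^ k) ^ (-(5 / 3 : ℝ)) *
        ∫ x in {x : EuclideanSpace ℝ (Fin 3) | lam ^ k < ‖x‖ ∧ ‖x‖ < lam ^ (k + 1)}, ‖Q x - V x‖ ^ 2)
        atTop (𝓝 0)) :
    ∀ᶠ k : ℕ in atTop,
      (lam ^ k) ^ (5 / 3 : ℝ) * ((∫ x in {x : EuclideanSpace ℝ (Fin 3) | 1 < ‖x‖ ∧ ‖x‖ < lam}, ‖V x‖ ^ 2) / 4) ≤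
        ∫ x in {x : EuclideanSpace ℝ (Fin 3) | lam ^ k < ‖x‖ ∧ ‖x‖ < lam ^ (k + 1)}, ‖Q x‖ ^ 2 := by
  set c₀ : ℝ := ∫ x in {x : EuclideanSpace ℝ (Fin 3) | 1 < ‖x‖ ∧ ‖x‖ < lam}, ‖V x‖ ^ 2 with hc₀
  have hlam0 : 0 < lam := by linarith
  -- shells are measurable; continuous fields are integrable on them
  have hmeas : ∀ a b : ℝ, MeasurableSet {x : EuclideanSpace ℝ (Fin 3) | a < ‖x‖ ∧ ‖x‖ < b} := fun a b =>
    ((isOpen_lt continuous_const continuous_norm).inter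
      (isOpen_lt continuous_norm continuous_const)).measurableSet
  have hcont : ∀ {g : EuclideanSpace ℝ (Fin 3) → ℝ}, Continuous g → ∀ a b : ℝ,
      IntegrableOn g {x : EuclideanSpace ℝ (Fin 3) | a < ‖x‖ ∧ ‖x‖ < b} volume := fun hg a b =>
    (hg.continuousOn.integrableOn_compact (isCompact_closedBall (0 : EuclideanSpace ℝ (Fin 3)) b)).mono_set
      fun x hx => by
        rw [Metric.mem_closedBall, dist_zero_right]
        exact hx.2.le
  rcases le_or_gt c₀ 0 with hc | hc
  · refine Eventually.of_forall fun k => ?_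
    have h1 : 0 ≤ ∫ x in {x : EuclideanSpace ℝ (Fin 3) | lam ^ k < ‖x‖ ∧ ‖x‖ < lam ^ (k + 1)}, ‖Q x‖ ^ 2 :=
      setIntegral_nonneg (hmeas _ _) fun x _ => sq_nonneg _
    have h2 : (lam ^ k) ^ (5 / 3 : ℝ) * (c₀ / 4) ≤ 0 :=
      mul_nonpos_of_nonneg_of_nonpos (Real.rpow_nonneg (pow_nonneg hlam0.le k) _) (by linarith)
    linarith
  · have hev : ∀ᶠ k : ℕ in atTop, (lam ^ k) ^ (-(5 / 3 : ℝ)) *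
        ∫ x in {x : EuclideanSpace ℝ (Fin 3) | lam ^ k < ‖x‖ ∧ ‖x‖ < lam ^ (k + 1)}, ‖Q x - V x‖ ^ 2 <
          c₀ / 4 :=
      hTend.eventually (gt_mem_nhds (by linarith))
    filter_upwards [hev] with k hk
    have hLk : 0 < lam ^ k := pow_pos hlam0 k
    have hL : 0 < (lam ^ k) ^ (5 / 3 : ℝ) := Real.rpow_pos_of_pos hLk _
    -- the error bound
    have hB : ∫ x in {x : EuclideanSpace ℝ (Fin 3) | lam ^ k < ‖x‖ ∧ ‖x‖ < lam ^ (k + 1)}, ‖Q x - V x‖ ^ 2 <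
        (c₀ / 4) * (lam ^ k) ^ (5 / 3 : ℝ) := by
      rw [Real.rpow_neg hLk.le] at hk
      rwa [inv_mul_lt_iff₀ hL, mul_comm] at hk
    -- the exact mass of `V` on the shell (landed DSS change of variables)
    have hVk : ∫ x in {x : EuclideanSpace ℝ (Fin 3) | lam ^ k < ‖x‖ ∧ ‖x‖ < lam ^ (k + 1)}, ‖V x‖ ^ 2 =
        (lam ^ k) ^ (5 / 3 : ℝ) * c₀ :=
      coneEnvelope_setIntegral_shell_normSq hlam0 hVss k
    -- integrability on the shell
    have iQ : IntegrableOn (fun x => ‖Q x‖ ^ 2)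
        {x : EuclideanSpace ℝ (Fin 3) | lam ^ k < ‖x‖ ∧ ‖x‖ < lam ^ (k + 1)} volume := hcont (hQ.norm.pow 2) _ _
    have iV : IntegrableOn (fun x => ‖V x‖ ^ 2)
        {x : EuclideanSpace ℝ (Fin 3) | lam ^ k < ‖x‖ ∧ ‖x‖ < lam ^ (k + 1)} volume :=
      coneEnvelope_integrableOn_shell hVloc _ hLk
    have i2 : IntegrableOn (fun x => 2 * ‖Q x‖ ^ 2 + 2 * ‖V x‖ ^ 2)
        {x : EuclideanSpace ℝ (Fin 3) | lam ^ k < ‖x‖ ∧ ‖x‖ < lam ^ (k + 1)} volume :=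
      (iQ.const_mul 2).add (iV.const_mul 2)
    have iD : IntegrableOn (fun x => ‖Q x - V x‖ ^ 2)
        {x : EuclideanSpace ℝ (Fin 3) | lam ^ k < ‖x‖ ∧ ‖x‖ < lam ^ (k + 1)} volume := by
      refine Integrable.mono' i2 ((hQ.aestronglyMeasurable.sub hV).norm.pow 2).restrict
        (ae_of_all _ fun x => ?_)
      rw [Real.norm_eq_abs, abs_of_nonneg (sq_nonneg _)]
      have h := norm_sub_le (Q x) (V x)
      nlinarith [norm_nonneg (Q x - V x), norm_nonneg (Q x), norm_nonneg (V x),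
        sq_nonneg (‖Q x‖ - ‖V x‖)]
    have hmono : ∫ x in {x : EuclideanSpace ℝ (Fin 3) | lam ^ k < ‖x‖ ∧ ‖x‖ < lam ^ (k + 1)}, ‖V x‖ ^ 2 ≤
        ∫ x in {x : EuclideanSpace ℝ (Fin 3) | lam ^ k < ‖x‖ ∧ ‖x‖ < lam ^ (k + 1)},
          (2 * ‖Q x‖ ^ 2 + 2 * ‖Q x - V x‖ ^ 2) := by
      refine integral_mono iV ((iQ.const_mul 2).add (iD.const_mul 2)) fun x => ?_
      have h := norm_sub_le (Q x) (Q x - V x)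
      rw [sub_sub_cancel] at h
      dsimp only
      nlinarith [norm_nonneg (V x), norm_nonneg (Q x), norm_nonneg (Q x - V x),
        sq_nonneg (‖Q x‖ - ‖Q x - V x‖)]
    rw [integral_add (iQ.const_mul 2) (iD.const_mul 2), integral_const_mul, integral_const_mul,
      hVk] at hmono
    nlinarith

/-- The floor `(λ^k)^{5/3} c` tends to `+∞` (`λ > 1`, `c > 0`). [folklore] -/
theorem tendsto_rpow_pow_five_thirds_mul_atTop {lam c : ℝ} (hlam : 1 < lam) (hc : 0 < c) :
    Tendsto (fun k : ℕ => (lam ^ k) ^ (5 / 3 : ℝ) * c) atTop atTop := by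
  have h0 : (0 : ℝ) ≤ lam := by linarith
  have h1 : 1 < lam ^ (5 / 3 : ℝ) := Real.one_lt_rpow hlam (by norm_num)
  have h3 : (fun k : ℕ => (lam ^ k) ^ (5 / 3 : ℝ) * c) = fun k => (lam ^ (5 / 3 : ℝ)) ^ k * c := by
    funext k
    congr 1
    rw [← Real.rpow_natCast_mul h0, mul_comm (k : ℝ), Real.rpow_mul_natCast h0]
  rw [h3]
  exact (tendsto_pow_atTop_atTop_of_one_lt h1).atTop_mul_const hc

/-! ## Refuted strengthening 1: finite energy -/

/-- **A cascade soliton has infinite energy** (refuted strengthening `Q ∈ L²(ℝ³)` of the conclusion):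
the far-field clause with a far field that is non-trivial on the fundamental shell forbids
`∫_{ℝ³} ‖Q‖² < ∞` — the shell masses `∫_{shell k}‖Q‖² ≥ (λ^k)^{5/3} c₀/4` are unbounded, while each is
at most `∫ ‖Q‖²`. [folklore] -/
theorem not_integrable_normSq_of_farField {lam : ℝ}
    {V Q : EuclideanSpace ℝ (Fin 3) → EuclideanSpace ℝ (Fin 3)} (hlam : 1 < lam)
    (hQ : Continuous Q) (hV : AEStronglyMeasurable V volume)
    (hVss : ∀ x : EuclideanSpace ℝ (Fin 3), x ≠ 0 → V (lam • x) = lam ^ (-(2 / 3 : ℝ)) • V x)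
    (hVloc : LocallyIntegrableOn (fun x => ‖V x‖ ^ 2) {x : EuclideanSpace ℝ (Fin 3) | x ≠ 0} volume)
    (hpos : 0 < ∫ x in {x : EuclideanSpace ℝ (Fin 3) | 1 < ‖x‖ ∧ ‖x‖ < lam}, ‖V x‖ ^ 2)
    (hTend : Tendsto (fun k : ℕ => (lam ^ k) ^ (-(5 / 3 : ℝ)) *
        ∫ x in {x : EuclideanSpace ℝ (Fin 3) | lam ^ k < ‖x‖ ∧ ‖x‖ < lam ^ (k + 1)}, ‖Q x - V x‖ ^ 2)
        atTop (𝓝 0)) :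
    ¬ Integrable (fun x => ‖Q x‖ ^ 2) volume := by
  intro hint
  have hle : ∀ k : ℕ,
      ∫ x in {x : EuclideanSpace ℝ (Fin 3) | lam ^ k < ‖x‖ ∧ ‖x‖ < lam ^ (k + 1)}, ‖Q x‖ ^ 2 ≤
        ∫ x, ‖Q x‖ ^ 2 := fun k =>
    setIntegral_le_integral hint (ae_of_all _ fun x => sq_nonneg _)
  have hfloor := shell_mass_floor hlam hQ hV hVss hVloc hTend
  have hbig := (tendsto_rpow_pow_five_thirds_mul_atTop hlam
    (show 0 < (∫ x in {x : EuclideanSpace ℝ (Fin 3) | 1 < ‖x‖ ∧ ‖x‖ < lam}, ‖V x‖ ^ 2) / 4 by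
      linarith)).eventually_gt_atTop (∫ x, ‖Q x‖ ^ 2)
  obtain ⟨k, hk1, hk2⟩ := (hfloor.and hbig).exists
  linarith [hle k]

/-- **No finite-energy cascade soliton**: the conclusion of `ConeDesingularisation` (= the body of
`CascadeSoliton`) is incompatible with `∫_{ℝ³}‖Q‖² < ∞`; only the smoothness of `Q` and the far-field
block are used. [folklore] -/
theorem cascadeSoliton_infinite_energy
    (Q : EuclideanSpace ℝ (Fin 3) → EuclideanSpace ℝ (Fin 3)) (P : EuclideanSpace ℝ (Fin 3) → ℝ)
    (hNS : IsClassicalNSSolutionOn Set.univ 1 (fun _ _ => 0) (fun _ => Q) (fun _ => P))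
    (hfar : ∃ (lam : ℝ) (V : EuclideanSpace ℝ (Fin 3) → EuclideanSpace ℝ (Fin 3)),
      1 < lam ∧ AEStronglyMeasurable V volume ∧
      (∀ x : EuclideanSpace ℝ (Fin 3), x ≠ 0 → V (lam • x) = lam ^ (-(2 / 3 : ℝ)) • V x) ∧
      LocallyIntegrableOn (fun x => ‖V x‖ ^ 2) {x : EuclideanSpace ℝ (Fin 3) | x ≠ 0} volume ∧
      0 < ∫ x in {x : EuclideanSpace ℝ (Fin 3) | 1 < ‖x‖ ∧ ‖x‖ < lam}, ‖V x‖ ^ 2 ∧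
      Tendsto (fun k : ℕ => (lam ^ k) ^ (-(5 / 3 : ℝ)) *
        ∫ x in {x : EuclideanSpace ℝ (Fin 3) | lam ^ k < ‖x‖ ∧ ‖x‖ < lam ^ (k + 1)}, ‖Q x - V x‖ ^ 2)
        atTop (𝓝 0)) :
    ¬ Integrable (fun x => ‖Q x‖ ^ 2) volume := by
  obtain ⟨lam, V, hlam, hV, hVss, hVloc, hpos, hTend⟩ := hfar
  exact not_integrable_normSq_of_farField hlam (hNS.contDiff_velocity (mem_univ (0 : ℝ))).continuous
    hV hVss hVloc hpos hTend

/-! ## Refuted strengthening 2: a sub-critical envelope -/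

/-- **The envelope exponent `5/3` is sharp** (refuted strengthening of the conclusion): under the
far-field clause with a non-trivial far field, NO envelope `∫_{B_R}‖Q‖² ≤ C R^s` (`R ≥ 1`) with `s < 5/3`
holds — the shell `λ^k < ‖x‖ < λ^{k+1}` lies in `B_{λ^{k+1}}` and already carries mass
`≥ (λ^k)^{5/3} c₀/4 ≫ C λ^{(k+1)s}`. [folklore] -/
theorem not_envelope_of_lt {lam : ℝ} {V Q : EuclideanSpace ℝ (Fin 3) → EuclideanSpace ℝ (Fin 3)}
    (hlam : 1 < lam) (hQ : Continuous Q) (hV : AEStronglyMeasurable V volume)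
    (hVss : ∀ x : EuclideanSpace ℝ (Fin 3), x ≠ 0 → V (lam • x) = lam ^ (-(2 / 3 : ℝ)) • V x)
    (hVloc : LocallyIntegrableOn (fun x => ‖V x‖ ^ 2) {x : EuclideanSpace ℝ (Fin 3) | x ≠ 0} volume)
    (hpos : 0 < ∫ x in {x : EuclideanSpace ℝ (Fin 3) | 1 < ‖x‖ ∧ ‖x‖ < lam}, ‖V x‖ ^ 2)
    (hTend : Tendsto (fun k : ℕ => (lam ^ k) ^ (-(5 / 3 : ℝ)) *
        ∫ x in {x : EuclideanSpace ℝ (Fin 3) | lam ^ k < ‖x‖ ∧ ‖x‖ < lam ^ (k + 1)}, ‖Q x - V x‖ ^ 2)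
        atTop (𝓝 0))
    {s : ℝ} (hs : s < 5 / 3) :
    ¬ ∃ C : ℝ, ∀ R : ℝ, 1 ≤ R →
      ∫ x in Metric.ball (0 : EuclideanSpace ℝ (Fin 3)) R, ‖Q x‖ ^ 2 ≤ C * R ^ s := by
  rintro ⟨C, hC⟩
  have hlam0 : 0 < lam := by linarith
  set c₀ : ℝ := ∫ x in {x : EuclideanSpace ℝ (Fin 3) | 1 < ‖x‖ ∧ ‖x‖ < lam}, ‖V x‖ ^ 2 with hc₀
  have hfloor := shell_mass_floor hlam hQ hV hVss hVloc hTend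
  -- upper bound on the shells from the envelope
  have hup : ∀ k : ℕ,
      ∫ x in {x : EuclideanSpace ℝ (Fin 3) | lam ^ k < ‖x‖ ∧ ‖x‖ < lam ^ (k + 1)}, ‖Q x‖ ^ 2 ≤
        C * lam ^ s * (lam ^ (s - 5 / 3)) ^ k * (lam ^ k) ^ (5 / 3 : ℝ) := by
    intro k
    have hLk : 0 < lam ^ k := pow_pos hlam0 k
    have hsub : {x : EuclideanSpace ℝ (Fin 3) | lam ^ k < ‖x‖ ∧ ‖x‖ < lam ^ (k + 1)} ⊆
        Metric.ball (0 : EuclideanSpace ℝ (Fin 3)) (lam ^ (k + 1)) :=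
      fun x hx => by rw [Metric.mem_ball, dist_zero_right]; exact hx.2
    have iQ : IntegrableOn (fun x => ‖Q x‖ ^ 2) (Metric.ball (0 : EuclideanSpace ℝ (Fin 3)) (lam ^ (k + 1)))
        volume :=
      ((hQ.norm.pow 2).continuousOn.integrableOn_compact
        (isCompact_closedBall (0 : EuclideanSpace ℝ (Fin 3)) (lam ^ (k + 1)))).mono_set
        Metric.ball_subset_closedBall
    have h1 : ∫ x in {x : EuclideanSpace ℝ (Fin 3) | lam ^ k < ‖x‖ ∧ ‖x‖ < lam ^ (k + 1)}, ‖Q x‖ ^ 2 ≤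
        ∫ x in Metric.ball (0 : EuclideanSpace ℝ (Fin 3)) (lam ^ (k + 1)), ‖Q x‖ ^ 2 :=
      setIntegral_mono_set iQ (ae_of_all _ fun x => sq_nonneg _) (ae_of_all _ hsub)
    have h2 := hC (lam ^ (k + 1)) (one_le_pow₀ hlam.le)
    have h3 : C * (lam ^ (k + 1)) ^ s =
        C * lam ^ s * (lam ^ (s - 5 / 3)) ^ k * (lam ^ k) ^ (5 / 3 : ℝ) := by
      have hcomm : (lam ^ (s - 5 / 3)) ^ k = (lam ^ k) ^ (s - 5 / 3) := by
        rw [← Real.rpow_mul_natCast hlam0.le, mul_comm, Real.rpow_natCast_mul hlam0.le]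
      rw [pow_succ', Real.mul_rpow hlam0.le hLk.le, hcomm, Real.rpow_sub hLk,
        mul_assoc, mul_assoc, div_mul_cancel₀ _ (Real.rpow_pos_of_pos hLk _).ne']
    linarith
  -- combine with the floor: `c₀/4 ≤ C λ^s q^k` eventually, `q = λ^{s-5/3} < 1`
  have hkey : ∀ᶠ k : ℕ in atTop, c₀ / 4 ≤ C * lam ^ s * (lam ^ (s - 5 / 3)) ^ k := by
    filter_upwards [hfloor] with k hk
    have hL : 0 < (lam ^ k) ^ (5 / 3 : ℝ) := Real.rpow_pos_of_pos (pow_pos hlam0 k) _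
    have := hk.trans (hup k)
    rw [mul_comm] at this
    exact le_of_mul_le_mul_right this hL
  have hq0 : 0 ≤ lam ^ (s - 5 / 3) := Real.rpow_nonneg hlam0.le _
  have hq1 : lam ^ (s - 5 / 3) < 1 := Real.rpow_lt_one_of_one_lt_of_neg hlam (by linarith)
  have hlim : Tendsto (fun k : ℕ => C * lam ^ s * (lam ^ (s - 5 / 3)) ^ k) atTop (𝓝 0) := by
    simpa using (tendsto_pow_atTop_nhds_zero_of_lt_one hq0 hq1).const_mul (C * lam ^ s)
  have hsmall : ∀ᶠ k : ℕ in atTop, C * lam ^ s * (lam ^ (s - 5 / 3)) ^ k < c₀ / 4 :=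
    (tendsto_order.1 hlim).2 _ (by linarith)
  obtain ⟨k, hk1, hk2⟩ := (hkey.and hsmall).exists
  linarith

/-- **The conclusion with a sub-critical envelope is false**: replacing the exponent `5/3` of the
`L²`-mass envelope by any `s < 5/3` (all other clauses of the conclusion of `ConeDesingularisation`
verbatim) gives an unsatisfiable statement. (`s = 5/3` is verbatim `CascadeSoliton`, believed false but
OPEN — Galdi's Liouville problem in the critical `L²`-mass class.) [folklore] -/
theorem not_cascadeSoliton_with_envelope_lt {s : ℝ} (hs : s < 5 / 3) :
    ¬ ∃ (Q : EuclideanSpace ℝ (Fin 3) → EuclideanSpace ℝ (Fin 3)) (P : EuclideanSpace ℝ (Fin 3) → ℝ),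
      IsClassicalNSSolutionOn Set.univ 1 (fun _ _ => 0) (fun _ => Q) (fun _ => P) ∧
      (∃ C : ℝ, ∀ R : ℝ, 1 ≤ R →
        ∫ x in Metric.ball (0 : EuclideanSpace ℝ (Fin 3)) R, ‖Q x‖ ^ 2 ≤ C * R ^ s) ∧
      Integrable (fun x => frobeniusNormSq (fderiv ℝ Q x)) ∧
      0 < ∫ x, frobeniusNormSq (fderiv ℝ Q x) ∧
      ∃ (lam : ℝ) (V : EuclideanSpace ℝ (Fin 3) → EuclideanSpace ℝ (Fin 3)),
        1 < lam ∧ AEStronglyMeasurable V volume ∧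
        (∀ x : EuclideanSpace ℝ (Fin 3), x ≠ 0 → V (lam • x) = lam ^ (-(2 / 3 : ℝ)) • V x) ∧
        LocallyIntegrableOn (fun x => ‖V x‖ ^ 2) {x : EuclideanSpace ℝ (Fin 3) | x ≠ 0} volume ∧
        0 < ∫ x in {x : EuclideanSpace ℝ (Fin 3) | 1 < ‖x‖ ∧ ‖x‖ < lam}, ‖V x‖ ^ 2 ∧
        Tendsto (fun k : ℕ => (lam ^ k) ^ (-(5 / 3 : ℝ)) *
          ∫ x in {x : EuclideanSpace ℝ (Fin 3) | lam ^ k < ‖x‖ ∧ ‖x‖ < lam ^ (k + 1)}, ‖Q x - V x‖ ^ 2)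
          atTop (𝓝 0) := by
  rintro ⟨Q, P, hNS, hC, -, -, lam, V, hlam, hV, hVss, hVloc, hpos, hTend⟩
  exact not_envelope_of_lt hlam (hNS.contDiff_velocity (mem_univ (0 : ℝ))).continuous hV hVss hVloc
    hpos hTend hs hC

/-- **With a sub-critical envelope the crux collapses to `¬ PointFluxCone`**: the strengthening
`PointFluxCone → (CascadeSoliton with envelope exponent s < 5/3)` of `ConeDesingularisation` holds iff
the rank-2 crux `PointFluxCone` of the same route FAILS — i.e. only where the route is dead by its own
kill criterion (k1). Information for the planner: the exponent `5/3` in the crux is the only value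
compatible with the far-field clause. [folklore] -/
theorem coneDesingularisation_with_envelope_lt_iff {s : ℝ} (hs : s < 5 / 3) :
    (PointFluxCone →
      ∃ (Q : EuclideanSpace ℝ (Fin 3) → EuclideanSpace ℝ (Fin 3)) (P : EuclideanSpace ℝ (Fin 3) → ℝ),
      IsClassicalNSSolutionOn Set.univ 1 (fun _ _ => 0) (fun _ => Q) (fun _ => P) ∧
      (∃ C : ℝ, ∀ R : ℝ, 1 ≤ R →
        ∫ x in Metric.ball (0 : EuclideanSpace ℝ (Fin 3)) R, ‖Q x‖ ^ 2 ≤ C * R ^ s) ∧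
      Integrable (fun x => frobeniusNormSq (fderiv ℝ Q x)) ∧
      0 < ∫ x, frobeniusNormSq (fderiv ℝ Q x) ∧
      ∃ (lam : ℝ) (V : EuclideanSpace ℝ (Fin 3) → EuclideanSpace ℝ (Fin 3)),
        1 < lam ∧ AEStronglyMeasurable V volume ∧
        (∀ x : EuclideanSpace ℝ (Fin 3), x ≠ 0 → V (lam • x) = lam ^ (-(2 / 3 : ℝ)) • V x) ∧
        LocallyIntegrableOn (fun x => ‖V x‖ ^ 2) {x : EuclideanSpace ℝ (Fin 3) | x ≠ 0} volume ∧
        0 < ∫ x in {x : EuclideanSpace ℝ (Fin 3) | 1 < ‖x‖ ∧ ‖x‖ < lam}, ‖V x‖ ^ 2 ∧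
        Tendsto (fun k : ℕ => (lam ^ k) ^ (-(5 / 3 : ℝ)) *
          ∫ x in {x : EuclideanSpace ℝ (Fin 3) | lam ^ k < ‖x‖ ∧ ‖x‖ < lam ^ (k + 1)}, ‖Q x - V x‖ ^ 2)
          atTop (𝓝 0)) ↔
    ¬ PointFluxCone :=
  ⟨fun h hc => not_cascadeSoliton_with_envelope_lt hs (h hc), fun h hc => absurd hc h⟩

end Summit.AnomalousDissipation.AnomalousDissipation.Theorems.ConeDesingularisation.Negative

end
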